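import Summits.QuantumFields.YangMills.Theorems.BalabanUVNodesN18KingModelTorusHolderMassUniform

/-!
# BalabanUVNodes ∕ N18 — King's (3.75), SECOND LINE (the Hölder quotient of the lattice DERIVATIVE `∂_α(x, y)∂^η_μ` on an
# external line), `j ≥ 1`, FOR KING'S ACTUAL OPERATORS ON BAŁABAN'S TORI — THE MASS-UNIFORM EDITION: `κ, C₅` functions of
# `(d, L, a, m₀², γ, α)` ONLY, EVERY domain reading ITS OWN mass in `(0, m₀²]`, in particular King's PHYSICAL slice masses
# `m²(L^jη)²` of (2.20) (Track A, DAG node N18 = NE5 `T4OutputRate.NE5 EA EB W κ θ C₅` :211; cluster K4; row s3 «King-model transfer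
# `N18KingModelTorus` (κ, C₅ from (d, L, a, m², γ))»; module 15 of seat pub-ymgap-dag-n18-e (g26), `--supports stmt-QuantumFields-20544
# --as helper` = K3⁷ `SpineGivenEndpointR13SepCoPH`)

HONEST FRAMING.  Count-neutral kernel bookkeeping.  King's A = 0 scalar MODEL of the NE5 mechanism on finite tori (template
literature, published and proved) — NOT Bałaban's covariant one-step outputs `E^{(j)}(X; g, U)`, for which NE5 is NOT IN PRINT and
has no tree producer; NOT a node discharge; nothing continuum ∕ ℝ⁴ ∕ OS ∕ mass-gap ∕ Clay.  THEOREMS ONLY: 0 `def`, 0 `sorry`,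
standard axioms.

THE POINT.  `N18KingModelTorusHolderDeriv.ne5_kingModel_threeFactorHolderDeriv_torus` (p-TorusHolderDeriv of the -a∕-b loop)
delivers King's (3.75), SECOND line (`∂^η_μ` inside the Hölder quotient, `α + γ < 1`), as a multi-scale `NE5` inhabitant with ONE
lattice-unit mass `m²` at EVERY scale — unphysical across scales by King's (2.20) (the slice of scale `j` carries `m²(L^jη)²`).
Its mass-dependent inputs are now mass-uniform in the tree: `holder_dkernel_decay_blocks_unif` (n15-e, `MinimizerHolderDecayUniform`,
p543533) and `king_prop38_holder_deriv_torus_blocks_unif` (this seat, `MinimizerHolderRateUniform`; the sup rate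
`king_prop38_holder_deriv_torus` was mass-free from the start).  THIS FILE re-runs p-TorusHolderDeriv through the mass-profile
assembly `N18KingModelTorusHolderMassUniform.ne5_of_threeFactorRates_lemma45_pair_massProfile` (module 14 §1):
* §1 **`ne5_kingModel_threeFactorHolderDeriv_torus_unif`** — `κ > 0`, `C₅ ≥ 0` functions of `(d, L, a, m₀², γ, α)` ONLY, such
  that p-TorusHolderDeriv's conclusion `NE5 EA EB W κ (L^{−γ∕2}) C₅` holds for EVERY MASS PROFILE `0 < mass X ≤ m₀²`.
* §2 **`ne5_kingModel_threeFactorHolderDeriv_torus_physMass`** — §1 at King's PHYSICAL profile `mass X = m²·(L^{scale X}·eps L k)²`.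
With modules 12, 13, 14 and this file, EVERY displayed bound of Prop. 3.9 for the scalar propagators `G_{(j)}`, `j ≥ 1` — (3.73)
both entries, (3.75) both entries — is a multi-scale `NE5` inhabitant for King's actual operators on Bałaban's tori with the
constants UNIFORM IN THE MASS and the slices reading their (2.20) masses.
HONEST SCOPE.  (i) `A = 0`, periodic b.c., odd `L ≥ 3`, `m² > 0`, flat blocks; (ii) lattice units of scale `j` (the factor
`(L^jη)^{1−d−α−γ}` of (3.75) is NOT inserted); (iii) `j ≥ 1`; (iv) `α + γ < 1` (the derivative line's alias exponent); (v) `|x − y|`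
= `holdist`; (3.74) (contour operator) not a scalar-template object; (vi) not Bałaban's `E^{(j)}(X; g, U)`; not a discharge.
Inputs BY NAME: `holder_dkernel_decay_blocks_unif` (n15-e), `king_prop38_holder_deriv_torus_blocks_unif` (this seat, Literature),
`ne5_of_threeFactorRates_lemma45_pair_massProfile` (module 14), `minimiser_row_decay_unif`, `minimiser_row_rate_unif`,
`physMass_pos`, `physMass_le_cap` (module 12), `fprop38Const_le_unif`, `sqrt_rate_le_unif`, `aliasConst_nonneg_of_lt_one`
(`N18KingModelScalesPair`), `outerRate_le_unif`, `blockOf_over`, `tdistT_symm`, `exp_decay_mono`.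

Sources: C. King, Commun. Math. Phys. **102** (1986) 649–677 [King1986] — (2.17) p. 653, (2.20) p. 654, Thm 3.3 (3.6)–(3.8)
pp. 655–656 (derivative and Hölder clauses), (3.62) p. 663, Prop. 3.7 (3.64)–(3.65) p. 663, Prop. 3.8 (3.71) p. 664 (lines 1 and
4), Prop. 3.9 (3.75) p. 665, Lemma 4.5 (4.38) p. 674, (4.42)–(4.43) p. 675; T. Bałaban, Commun. Math. Phys. **89** (1983) 571–597
[Balaban1983RegularityDecay] Thm (1.9)–(1.10) p. 573 (the mass-uniform root); T. Bałaban, Commun. Math. Phys. **109** (1987)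
249–301 [Balaban1987RG1] (0.24)–(0.25) p. 257 (the only printed trace of NE5).  No claim about the mass gap.
-/

noncomputable section

namespace Summit.QuantumFields.YangMills.BalabanUVNodes.N18KingModelTorusHolderDerivMassUniform

open Real Matrix
open Literature.MathematicalPhysics.QuantumFieldTheory.Balaban1983to89 (Params)
open Literature.MathematicalPhysics.QuantumFieldTheory.Balaban1983to89.T4OutputRate (Carriers Functional NE5)
open Literature.MathematicalPhysics.QuantumFieldTheory.Balaban1983to89.B5Prop11Plancherel (Tor fine unitVec)
open Literature.MathematicalPhysics.QuantumFieldTheory.Balaban1983to89.B4Sect5Proof (latticeConst latticeConst_nonneg)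
open Literature.MathematicalPhysics.QuantumFieldTheory.King1986
  (aK lemma43Const prop38RateConst prop38PosConst fprop38RateConst fprop38PosConst exp_decay_mono)
open Literature.MathematicalPhysics.QuantumFieldTheory.King1986.ContinuumLimit (eps)
open Literature.MathematicalPhysics.QuantumFieldTheory.King1986.Torus
  (minimiser effLaplacian blockProj blockOf blockOf_over tdistT tdistT_symm tdistT_nonneg holdist K45 K45_nonneg delta45
    gam0L gam0L_pos delta45_pos holder_dkernel_decay_blocks_unif king_prop38_holder_deriv_torus_blocks_unif)
open Summit.QuantumFields.YangMills.BalabanUVNodes.N18KingModelTorus (outerRate_le_unif)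
open Summit.QuantumFields.YangMills.BalabanUVNodes.N18KingModelScalesPair
  (fprop38Const_le_unif sqrt_rate_le_unif aliasConst_nonneg_of_lt_one)
open Summit.QuantumFields.YangMills.BalabanUVNodes.N18KingModelTorusMassUniform
  (minimiser_row_decay_unif minimiser_row_rate_unif physMass_pos physMass_le_cap)
open Summit.QuantumFields.YangMills.BalabanUVNodes.N18KingModelTorusHolderMassUniform
  (ne5_of_threeFactorRates_lemma45_pair_massProfile)

variable {d : ℕ}

/-! ## §1 (3.75), second line (`∂^η_μ` inside the Hölder quotient), `j ≥ 1`, on Bałaban's tori — `κ, C₅` from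
`(d, L, a, m₀², γ, α)`, every domain its own mass -/

/-- **KING'S (3.75), SECOND LINE (THE HÖLDER QUOTIENT OF THE LATTICE DERIVATIVE `∂_α(x, y)∂^η_μ` ON THE LEFT EXTERNAL LINE),
`j ≥ 1`, MASS-UNIFORM — the derivative Hölder row's theorem of record with the mass quantified INSIDE.**  For `d ≥ 1`, odd
`L > 1`, `a > 0`, a cap `m₀² > 0`, `0 < α`, `0 < γ`, `α + γ < 1` there are `κ > 0`, `C₅ ≥ 0` — functions of `d, L, a, m₀², γ, α`
ONLY — such that: for every `n ≥ 1`; every family of unit tori `L·M_j(μ) = 2L^{m_j}`; every carriers `C` with `1 ≤ scale X` whose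
domain `X` of scale `j` reads a direction `μ(X)` and three fine points `x_A`, `y_A`, `z_A` under `x_B`, `y_B`, `z_B`, tree length
`≤ dist({B(x_A), B(y_A)}, B(z_A))`; EVERY MASS PROFILE `0 < mass X ≤ m₀²`; every two functionals reading the (4.42) graphs with the
row `u ↦ |x_A − y_A|^{−α}(∂^η_μℋ_j(x_A, u) − ∂^η_μℋ_j(y_A, u))`, `∂^η_μℋ_j(x, u) = L^j(ℋ_j(x + e_μ, u) − ℋ_j(x, u))` (run B at `j + n`
with primes) AT THE MASS `mass X`; every window: `NE5 EA EB W κ (L^{−γ∕2}) C₅`.  Composition as module 14 §2 with `hu` ≔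
`holder_dkernel_decay_blocks_unif`, `hdu` ≔ `king_prop38_holder_deriv_torus_blocks_unif` (∘ `fprop38Const_le_unif` at `β = α + 1`,
∘ `sqrt_rate_le_unif`), `hv`∕`hdv` ≔ `minimiser_row_decay_unif`∕`minimiser_row_rate_unif`.
`N18KingModelTorusHolderDeriv.ne5_kingModel_threeFactorHolderDeriv_torus` = the constant profile `mass X = m²`, cap `m²`.  A = 0 MODEL.
[cite: King1986, (2.20) p.654, Prop. 3.9 (3.75) p.665, (3.62) p.663, (4.42)–(4.43) p.675, Prop. 3.8 (3.71) p.664, Theorem 3.3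
(3.8) p.658; Balaban1983RegularityDecay, Theorem (1.9)–(1.10) p.573] -/
theorem ne5_kingModel_threeFactorHolderDeriv_torus_unif (hd : 1 ≤ d) (L : ℕ) [NeZero L] (hLp : Odd L ∧ 1 < L) {a : ℝ}
    (ha : 0 < a) {m0sq : ℝ} (hm0 : 0 < m0sq) {α γ : ℝ} (hα : 0 < α) (hγ : 0 < γ) (hαγ : α + γ < 1) :
    ∃ κ C₅ : ℝ, 0 < κ ∧ 0 ≤ C₅ ∧
      ∀ (n : ℕ) (_hn : 1 ≤ n) (M : ℕ → Fin d → ℕ) [∀ j μ, NeZero (M j μ)]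
        (_hM : ∀ j, ∃ mm : ℕ, ∀ μ, L * M j μ = 2 * L ^ mm)
        (C : Carriers) (_hsc : ∀ X, 1 ≤ C.scale X) (dir : C.Dom → Fin d)
        (xA yA zA : (X : C.Dom) → Tor (fine (L ^ C.scale X) (fine L (M (C.scale X)))))
        (xB yB zB : (X : C.Dom) → Tor (fine (L ^ n * L ^ C.scale X) (fine L (M (C.scale X)))))
        (_hx : ∀ X μ, (xA X μ).val = (xB X μ).val / L ^ n)
        (_hy : ∀ X μ, (yA X μ).val = (yB X μ).val / L ^ n)
        (_hz : ∀ X μ, (zA X μ).val = (zB X μ).val / L ^ n)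
        (_hd : ∀ X, C.d X ≤ min
            (tdistT (fine L (M (C.scale X))) (blockOf (L ^ C.scale X) (fine L (M (C.scale X))) (xA X))
              (blockOf (L ^ C.scale X) (fine L (M (C.scale X))) (zA X)))
            (tdistT (fine L (M (C.scale X))) (blockOf (L ^ C.scale X) (fine L (M (C.scale X))) (yA X))
              (blockOf (L ^ C.scale X) (fine L (M (C.scale X))) (zA X))))
        (mass : C.Dom → ℝ) (_hmass : ∀ X, 0 < mass X) (_hcap : ∀ X, mass X ≤ m0sq)
        (EA : Functional C C.BgA) (EB : Functional C C.BgB)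
        (_hEA : ∀ g U X, EA g U X =
          (fun u => (holdist (L ^ C.scale X) (fine L (M (C.scale X))) (xA X) (yA X)) ^ (-α)
              * (((L ^ C.scale X : ℕ) : ℝ)
                  * (minimiser (L ^ C.scale X) (fine L (M (C.scale X))) (aK a L (C.scale X))
                        (((L ^ C.scale X : ℕ) : ℝ) ^ 2) (mass X) (Pi.single u 1)
                        (xA X + unitVec (fine (L ^ C.scale X) (fine L (M (C.scale X)))) (dir X))
                      - minimiser (L ^ C.scale X) (fine L (M (C.scale X))) (aK a L (C.scale X))
                        (((L ^ C.scale X : ℕ) : ℝ) ^ 2) (mass X) (Pi.single u 1) (xA X))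
                - ((L ^ C.scale X : ℕ) : ℝ)
                  * (minimiser (L ^ C.scale X) (fine L (M (C.scale X))) (aK a L (C.scale X))
                        (((L ^ C.scale X : ℕ) : ℝ) ^ 2) (mass X) (Pi.single u 1)
                        (yA X + unitVec (fine (L ^ C.scale X) (fine L (M (C.scale X)))) (dir X))
                      - minimiser (L ^ C.scale X) (fine L (M (C.scale X))) (aK a L (C.scale X))
                        (((L ^ C.scale X : ℕ) : ℝ) ^ 2) (mass X) (Pi.single u 1) (yA X))))
            ⬝ᵥ ((effLaplacian (L ^ C.scale X) (fine L (M (C.scale X))) (aK a L (C.scale X))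
                    (((L ^ C.scale X : ℕ) : ℝ) ^ 2) (mass X)
                  + (a * ((L : ℝ) ^ 2)⁻¹) • blockProj L (M (C.scale X)))⁻¹
                *ᵥ fun w => minimiser (L ^ C.scale X) (fine L (M (C.scale X))) (aK a L (C.scale X))
                    (((L ^ C.scale X : ℕ) : ℝ) ^ 2) (mass X) (Pi.single w 1) (zA X)))
        (_hEB : ∀ g U X, EB g U X =
          (fun u => (holdist (L ^ n * L ^ C.scale X) (fine L (M (C.scale X))) (xB X) (yB X)) ^ (-α)
              * (((L ^ n * L ^ C.scale X : ℕ) : ℝ)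
                  * (minimiser (L ^ n * L ^ C.scale X) (fine L (M (C.scale X))) (aK a L (C.scale X + n))
                        (((L ^ n * L ^ C.scale X : ℕ) : ℝ) ^ 2) (mass X) (Pi.single u 1)
                        (xB X + unitVec (fine (L ^ n * L ^ C.scale X) (fine L (M (C.scale X)))) (dir X))
                      - minimiser (L ^ n * L ^ C.scale X) (fine L (M (C.scale X))) (aK a L (C.scale X + n))
                        (((L ^ n * L ^ C.scale X : ℕ) : ℝ) ^ 2) (mass X) (Pi.single u 1) (xB X))
                - ((L ^ n * L ^ C.scale X : ℕ) : ℝ)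
                  * (minimiser (L ^ n * L ^ C.scale X) (fine L (M (C.scale X))) (aK a L (C.scale X + n))
                        (((L ^ n * L ^ C.scale X : ℕ) : ℝ) ^ 2) (mass X) (Pi.single u 1)
                        (yB X + unitVec (fine (L ^ n * L ^ C.scale X) (fine L (M (C.scale X)))) (dir X))
                      - minimiser (L ^ n * L ^ C.scale X) (fine L (M (C.scale X))) (aK a L (C.scale X + n))
                        (((L ^ n * L ^ C.scale X : ℕ) : ℝ) ^ 2) (mass X) (Pi.single u 1) (yB X))))
            ⬝ᵥ ((effLaplacian (L ^ n * L ^ C.scale X) (fine L (M (C.scale X))) (aK a L (C.scale X + n))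
                    (((L ^ n * L ^ C.scale X : ℕ) : ℝ) ^ 2) (mass X)
                  + (a * ((L : ℝ) ^ 2)⁻¹) • blockProj L (M (C.scale X)))⁻¹
                *ᵥ fun w => minimiser (L ^ n * L ^ C.scale X) (fine L (M (C.scale X))) (aK a L (C.scale X + n))
                    (((L ^ n * L ^ C.scale X : ℕ) : ℝ) ^ 2) (mass X) (Pi.single w 1) (zB X)))
        (W : Set (ℕ → ℝ)),
        NE5 EA EB W κ ((L : ℝ) ^ (-(γ / 2))) C₅ := by
  have hd0 : 0 < d := hd
  have hL2 : 2 ≤ L := by have := hLp.2; omega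
  have hα1 : α < 1 := by linarith
  have hγ1 : γ ≤ 1 := by linarith
  -- the outer-line packages, MASS INSIDE, BY NAME: the derivative Hölder row (n15-e's `_unif` decay, this seat's `_unif` rate),
  -- the column (module 12 §1)
  obtain ⟨δ₁, c₁, hδ₁, hc₁, H₁⟩ := holder_dkernel_decay_blocks_unif d L hd hLp.1 hL2 ha hm0.le hα hα1
  obtain ⟨δ₂, c₂, hδ₂, hc₂, H₂⟩ := minimiser_row_decay_unif d L hd hLp ha hm0.le
  obtain ⟨δ₃, c₃, hδ₃, hc₃, H₃⟩ := king_prop38_holder_deriv_torus_blocks_unif d L hd hLp.1 hL2 ha hm0.le hα hγ hαγ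
  obtain ⟨δ₄, c₄, hδ₄, hc₄, H₄⟩ := minimiser_row_rate_unif d L hd hLp.1 hL2 ha hm0.le hγ.le hγ1
  -- one common decay rate
  have hδ45 : 0 < delta45 d a L := delta45_pos (d := d) ha hL2
  set κ : ℝ := min (min (min δ₁ δ₂) (min (δ₃ / 2) (δ₄ / 2))) (delta45 d a L) with hκ_def
  have hκpos : 0 < κ :=
    lt_min (lt_min (lt_min hδ₁ hδ₂) (lt_min (half_pos hδ₃) (half_pos hδ₄))) hδ45
  have hκ₁ : κ ≤ δ₁ := (min_le_left _ _).trans ((min_le_left _ _).trans (min_le_left _ _))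
  have hκ₂ : κ ≤ δ₂ := (min_le_left _ _).trans ((min_le_left _ _).trans (min_le_right _ _))
  have hκ₃ : κ ≤ δ₃ / 2 := (min_le_left _ _).trans ((min_le_right _ _).trans (min_le_left _ _))
  have hκ₄ : κ ≤ δ₄ / 2 := (min_le_left _ _).trans ((min_le_right _ _).trans (min_le_right _ _))
  have hκ45 : κ ≤ delta45 d a L := min_le_right _ _
  -- the uniform letters
  set Cu : ℝ := prop38RateConst a a (a * (2 * ((a * (1 - ((L : ℝ) ^ 2)⁻¹))⁻¹ + π ^ 2 / 48 + 1 / 3)))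
      ((π ^ 2 / 4) ^ d) d γ + prop38PosConst a ((π ^ 2 / 4) ^ d) d γ with hCu
  set CuH : ℝ := fprop38RateConst a a (a * (2 * ((a * (1 - ((L : ℝ) ^ 2)⁻¹))⁻¹ + π ^ 2 / 48 + 1 / 3)))
      ((π ^ 2 / 4) ^ d) d γ (α + 1) (2 * (d : ℝ) ^ α) (2 * (d : ℝ) ^ α * 2 ^ (1 - γ))
      + fprop38PosConst a ((π ^ 2 / 4) ^ d) d γ (α + 1) (2 * (d : ℝ) ^ α) (6 * (d : ℝ) ^ (α + γ)) with hCuH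
  set cA : ℝ := Real.sqrt (2 * c₃ * CuH) with hcA
  set cB : ℝ := Real.sqrt (2 * (a * c₄) * Cu) with hcB
  have hcA0 : 0 ≤ cA := Real.sqrt_nonneg _
  have hcB0 : 0 ≤ cB := Real.sqrt_nonneg _
  have hsB : 0 ≤ a * c₂ := by positivity
  have hγ₀ : 0 < gam0L d a L := gam0L_pos ha hL2
  have hK45 : 0 ≤ K45 d a L := K45_nonneg a L
  have hKd : 0 ≤ latticeConst d (κ / 2) := latticeConst_nonneg d (half_pos hκpos).le
  have hAC : 0 ≤ Literature.MathematicalPhysics.QuantumFieldTheory.King1986.aliasConst d (α + 1 + γ - 1) :=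
    aliasConst_nonneg_of_lt_one hd0 (by linarith)
  refine ⟨κ / 2, 2 * ((cA * (2 / gam0L d a L) * (a * c₂) + c₁ * K45 d a L * (a * c₂)
      + c₁ * (2 / gam0L d a L) * cB) * (latticeConst d (κ / 2)) ^ 2), half_pos hκpos, by positivity, ?_⟩
  intro n hn M _ hM C hsc dir xA yA zA xB yB zB hx hy hz hdd mass hmass hcap EA EB hEA hEB W
  have hγ2 : γ / 2 ≤ 1 := by linarith
  -- every scale-`j` torus of the family is the unit torus of the Bałaban volume `(d, L, m_j, K)` for any `K`
  have hvol : ∀ (j K : ℕ), ∃ mm : ℕ, ∀ μ, fine L (M j) μ = (⟨d, L, mm, K, hd, hLp⟩ : Params).sitesPerDir K := fun j K => by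
    obtain ⟨mm, hmm⟩ := hM j
    exact ⟨mm, fun μ => by simp only [Params.sitesPerDir, Nat.add_sub_cancel]; exact hmm μ⟩
  refine ne5_of_threeFactorRates_lemma45_pair_massProfile (C := C) (EA := EA) (EB := EB) (W := W) L hL2 ha mass hmass hn M
    hγ2 hsc
    (fun X => blockOf (L ^ C.scale X) (fine L (M (C.scale X))) (xA X))
    (fun X => blockOf (L ^ C.scale X) (fine L (M (C.scale X))) (yA X))
    (fun X => blockOf (L ^ C.scale X) (fine L (M (C.scale X))) (zA X))
    (fun X u => (holdist (L ^ C.scale X) (fine L (M (C.scale X))) (xA X) (yA X)) ^ (-α)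
      * (((L ^ C.scale X : ℕ) : ℝ)
          * (minimiser (L ^ C.scale X) (fine L (M (C.scale X))) (aK a L (C.scale X))
                (((L ^ C.scale X : ℕ) : ℝ) ^ 2) (mass X) (Pi.single u 1)
                (xA X + unitVec (fine (L ^ C.scale X) (fine L (M (C.scale X)))) (dir X))
              - minimiser (L ^ C.scale X) (fine L (M (C.scale X))) (aK a L (C.scale X))
                (((L ^ C.scale X : ℕ) : ℝ) ^ 2) (mass X) (Pi.single u 1) (xA X))
        - ((L ^ C.scale X : ℕ) : ℝ)
          * (minimiser (L ^ C.scale X) (fine L (M (C.scale X))) (aK a L (C.scale X))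
                (((L ^ C.scale X : ℕ) : ℝ) ^ 2) (mass X) (Pi.single u 1)
                (yA X + unitVec (fine (L ^ C.scale X) (fine L (M (C.scale X)))) (dir X))
              - minimiser (L ^ C.scale X) (fine L (M (C.scale X))) (aK a L (C.scale X))
                (((L ^ C.scale X : ℕ) : ℝ) ^ 2) (mass X) (Pi.single u 1) (yA X))))
    (fun X u => (holdist (L ^ n * L ^ C.scale X) (fine L (M (C.scale X))) (xB X) (yB X)) ^ (-α)
      * (((L ^ n * L ^ C.scale X : ℕ) : ℝ)
          * (minimiser (L ^ n * L ^ C.scale X) (fine L (M (C.scale X))) (aK a L (C.scale X + n))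
                (((L ^ n * L ^ C.scale X : ℕ) : ℝ) ^ 2) (mass X) (Pi.single u 1)
                (xB X + unitVec (fine (L ^ n * L ^ C.scale X) (fine L (M (C.scale X)))) (dir X))
              - minimiser (L ^ n * L ^ C.scale X) (fine L (M (C.scale X))) (aK a L (C.scale X + n))
                (((L ^ n * L ^ C.scale X : ℕ) : ℝ) ^ 2) (mass X) (Pi.single u 1) (xB X))
        - ((L ^ n * L ^ C.scale X : ℕ) : ℝ)
          * (minimiser (L ^ n * L ^ C.scale X) (fine L (M (C.scale X))) (aK a L (C.scale X + n))
                (((L ^ n * L ^ C.scale X : ℕ) : ℝ) ^ 2) (mass X) (Pi.single u 1)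
                (yB X + unitVec (fine (L ^ n * L ^ C.scale X) (fine L (M (C.scale X)))) (dir X))
              - minimiser (L ^ n * L ^ C.scale X) (fine L (M (C.scale X))) (aK a L (C.scale X + n))
                (((L ^ n * L ^ C.scale X : ℕ) : ℝ) ^ 2) (mass X) (Pi.single u 1) (yB X))))
    (fun X w => minimiser (L ^ C.scale X) (fine L (M (C.scale X))) (aK a L (C.scale X))
      (((L ^ C.scale X : ℕ) : ℝ) ^ 2) (mass X) (Pi.single w 1) (zA X))
    (fun X w => minimiser (L ^ n * L ^ C.scale X) (fine L (M (C.scale X))) (aK a L (C.scale X + n))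
      (((L ^ n * L ^ C.scale X : ℕ) : ℝ) ^ 2) (mass X) (Pi.single w 1) (zB X))
    (fun X => (effLaplacian (L ^ C.scale X) (fine L (M (C.scale X))) (aK a L (C.scale X))
        (((L ^ C.scale X : ℕ) : ℝ) ^ 2) (mass X) + (a * ((L : ℝ) ^ 2)⁻¹) • blockProj L (M (C.scale X)))⁻¹)
    (fun X => (effLaplacian (L ^ n * L ^ C.scale X) (fine L (M (C.scale X))) (aK a L (C.scale X + n))
        (((L ^ n * L ^ C.scale X : ℕ) : ℝ) ^ 2) (mass X) + (a * ((L : ℝ) ^ 2)⁻¹) • blockProj L (M (C.scale X)))⁻¹)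
    (fun _ => rfl) (fun _ => rfl) hκpos hκ45 hc₁.le hsB hcA0 hcB0 ?_ ?_ ?_ ?_ hdd hEA hEB
  · -- `hu`: the derivative Hölder row at the mass `mass X`, pair-anchored (`holder_dkernel_decay_blocks_unif`)
    intro X u
    obtain ⟨mm, hMK⟩ := hvol (C.scale X) (C.scale X)
    have h := H₁ ⟨d, L, mm, C.scale X, hd, hLp⟩ rfl rfl (hsc X) (mass X) (hmass X) (hcap X) (fine L (M (C.scale X))) hMK
      (L ^ C.scale X) rfl (xA X) (yA X) u (dir X)
    exact h.trans (exp_decay_mono hc₁.le hκ₁ (le_min (tdistT_nonneg _ _ _) (tdistT_nonneg _ _ _)))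
  · -- `hv`: run B's column at the mass `mass X` (`minimiser_row_decay_unif` ∘ `blockOf_over` ∘ `tdistT_symm`)
    intro X w
    obtain ⟨mm, hMK⟩ := hvol (C.scale X) (C.scale X + n)
    have hN : L ^ n * L ^ C.scale X = L ^ (C.scale X + n) := by rw [pow_add, mul_comm]
    have h := H₂ ⟨d, L, mm, C.scale X + n, hd, hLp⟩ rfl rfl (show 1 ≤ C.scale X + n by have := hsc X; omega)
      (mass X) (hmass X).le (hcap X) (fine L (M (C.scale X))) hMK (L ^ n * L ^ C.scale X) hN κ hκpos hκ₂ (zB X) w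
    rw [blockOf_over (fine L (M (C.scale X))) (zA X) (zB X) (hz X), tdistT_symm] at h
    exact h
  · -- `hdu`: (3.71) line 4 in its printed shape at the mass `mass X` (`king_prop38_holder_deriv_torus_blocks_unif`), constant
    -- made `K, n`-free (`fprop38Const_le_unif`, `sqrt_rate_le_unif`), decay weakened from `δ₃∕2` to `κ`
    intro X u
    obtain ⟨mm, hMK⟩ := hvol (C.scale X) (C.scale X)
    haveI : NeZero (⟨d, L, mm, C.scale X, hd, hLp⟩ : Params).L := ‹NeZero L›
    have h := H₃ ⟨d, L, mm, C.scale X, hd, hLp⟩ rfl rfl (hsc X) (mass X) (hmass X) (hcap X) n hn (fine L (M (C.scale X)))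
      hMK (xA X) (yA X) (xB X) (yB X) u (hx X) (hy X) (dir X)
    have hmin : 0 ≤ min (tdistT (fine L (M (C.scale X))) (blockOf (L ^ C.scale X) (fine L (M (C.scale X))) (xA X)) u)
        (tdistT (fine L (M (C.scale X))) (blockOf (L ^ C.scale X) (fine L (M (C.scale X))) (yA X)) u) :=
      le_min (tdistT_nonneg _ _ _) (tdistT_nonneg _ _ _)
    refine (h.trans (exp_decay_mono (Real.sqrt_nonneg _) hκ₃ hmin)).trans ?_
    refine mul_le_mul_of_nonneg_right ?_ (Real.exp_pos _).le
    exact sqrt_rate_le_unif (fprop38Const_le_unif ha hL2 (hsc X) hn (by positivity) (by positivity) hAC)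
      (by positivity) L (C.scale X) γ
  · -- `hdv`: the column difference at the mass `mass X` (`minimiser_row_rate_unif` ∘ `outerRate_le_unif` ∘ `tdistT_symm`)
    intro X w
    obtain ⟨mm, hMK⟩ := hvol (C.scale X) (C.scale X)
    haveI : NeZero (⟨d, L, mm, C.scale X, hd, hLp⟩ : Params).L := ‹NeZero L›
    have h := H₄ ⟨d, L, mm, C.scale X, hd, hLp⟩ rfl rfl (hsc X) (mass X) (hmass X) (hcap X) n hn (fine L (M (C.scale X)))
      hMK κ hκpos hκ₄ (zA X) (zB X) w (hz X)
    rw [tdistT_symm (fine L (M (C.scale X))) w]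
    exact h.trans (mul_le_mul_of_nonneg_right (outerRate_le_unif hd0 ha hL2 (hsc X) hn hγ1 hc₄.le)
      (Real.exp_pos _).le)

/-! ## §2 King's PHYSICAL profile `m²(L^jη)²` of (2.20): one `(κ, C₅)` for all the slices of a run -/

/-- **KING'S (3.75), SECOND LINE, `j ≥ 1`, AT THE PHYSICAL MASSES OF (2.20).**  For `d ≥ 1`, odd `L > 1`, `a > 0`, a physical
mass `m² > 0`, `0 < α`, `0 < γ`, `α + γ < 1` there are `κ > 0`, `C₅ ≥ 0` (functions of `d, L, a, m², γ, α`) such that for EVERY run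
length `k`, every `n ≥ 1`, volumes, carriers with `1 ≤ scale X ≤ k`, the direction ∕ three fine points ∕ tree lengths of §1, and
functionals reading the derivative-Hölder (4.42) graphs of run A (slice `j = scale X` of `G^η_k`, `η = eps L k`) and run B (slice
`j + n` of `G^{η′}_{k+n}`) AT THE PHYSICAL LATTICE MASS `m²·(L^j·η)²`: `NE5 EA EB W κ (L^{−γ∕2}) C₅`.  §1 at the profile
`mass X = m²·(L^{scale X}·eps L k)²` (`physMass_pos`, `physMass_le_cap`).  A = 0 MODEL; lattice units of scale `j`.
[cite: King1986, (2.17) p.653, (2.20) p.654, Prop. 3.9 (3.75) p.665, (4.42)–(4.43) p.675] -/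
theorem ne5_kingModel_threeFactorHolderDeriv_torus_physMass (hd : 1 ≤ d) (L : ℕ) [NeZero L] (hLp : Odd L ∧ 1 < L) {a m2 : ℝ}
    (ha : 0 < a) (hm : 0 < m2) {α γ : ℝ} (hα : 0 < α) (hγ : 0 < γ) (hαγ : α + γ < 1) :
    ∃ κ C₅ : ℝ, 0 < κ ∧ 0 ≤ C₅ ∧
      ∀ (k n : ℕ) (_hn : 1 ≤ n) (M : ℕ → Fin d → ℕ) [∀ j μ, NeZero (M j μ)]
        (_hM : ∀ j, ∃ mm : ℕ, ∀ μ, L * M j μ = 2 * L ^ mm)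
        (C : Carriers) (_hsc : ∀ X, 1 ≤ C.scale X) (_hsk : ∀ X, C.scale X ≤ k) (dir : C.Dom → Fin d)
        (xA yA zA : (X : C.Dom) → Tor (fine (L ^ C.scale X) (fine L (M (C.scale X)))))
        (xB yB zB : (X : C.Dom) → Tor (fine (L ^ n * L ^ C.scale X) (fine L (M (C.scale X)))))
        (_hx : ∀ X μ, (xA X μ).val = (xB X μ).val / L ^ n)
        (_hy : ∀ X μ, (yA X μ).val = (yB X μ).val / L ^ n)
        (_hz : ∀ X μ, (zA X μ).val = (zB X μ).val / L ^ n)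
        (_hd : ∀ X, C.d X ≤ min
            (tdistT (fine L (M (C.scale X))) (blockOf (L ^ C.scale X) (fine L (M (C.scale X))) (xA X))
              (blockOf (L ^ C.scale X) (fine L (M (C.scale X))) (zA X)))
            (tdistT (fine L (M (C.scale X))) (blockOf (L ^ C.scale X) (fine L (M (C.scale X))) (yA X))
              (blockOf (L ^ C.scale X) (fine L (M (C.scale X))) (zA X))))
        (EA : Functional C C.BgA) (EB : Functional C C.BgB)
        (_hEA : ∀ g U X, EA g U X =
          (fun u => (holdist (L ^ C.scale X) (fine L (M (C.scale X))) (xA X) (yA X)) ^ (-α)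
              * (((L ^ C.scale X : ℕ) : ℝ)
                  * (minimiser (L ^ C.scale X) (fine L (M (C.scale X))) (aK a L (C.scale X))
                        (((L ^ C.scale X : ℕ) : ℝ) ^ 2) (m2 * ((L : ℝ) ^ C.scale X * eps L k) ^ 2) (Pi.single u 1)
                        (xA X + unitVec (fine (L ^ C.scale X) (fine L (M (C.scale X)))) (dir X))
                      - minimiser (L ^ C.scale X) (fine L (M (C.scale X))) (aK a L (C.scale X))
                        (((L ^ C.scale X : ℕ) : ℝ) ^ 2) (m2 * ((L : ℝ) ^ C.scale X * eps L k) ^ 2) (Pi.single u 1) (xA X))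
                - ((L ^ C.scale X : ℕ) : ℝ)
                  * (minimiser (L ^ C.scale X) (fine L (M (C.scale X))) (aK a L (C.scale X))
                        (((L ^ C.scale X : ℕ) : ℝ) ^ 2) (m2 * ((L : ℝ) ^ C.scale X * eps L k) ^ 2) (Pi.single u 1)
                        (yA X + unitVec (fine (L ^ C.scale X) (fine L (M (C.scale X)))) (dir X))
                      - minimiser (L ^ C.scale X) (fine L (M (C.scale X))) (aK a L (C.scale X))
                        (((L ^ C.scale X : ℕ) : ℝ) ^ 2) (m2 * ((L : ℝ) ^ C.scale X * eps L k) ^ 2) (Pi.single u 1) (yA X))))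
            ⬝ᵥ ((effLaplacian (L ^ C.scale X) (fine L (M (C.scale X))) (aK a L (C.scale X))
                    (((L ^ C.scale X : ℕ) : ℝ) ^ 2) (m2 * ((L : ℝ) ^ C.scale X * eps L k) ^ 2)
                  + (a * ((L : ℝ) ^ 2)⁻¹) • blockProj L (M (C.scale X)))⁻¹
                *ᵥ fun w => minimiser (L ^ C.scale X) (fine L (M (C.scale X))) (aK a L (C.scale X))
                    (((L ^ C.scale X : ℕ) : ℝ) ^ 2) (m2 * ((L : ℝ) ^ C.scale X * eps L k) ^ 2) (Pi.single w 1) (zA X)))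
        (_hEB : ∀ g U X, EB g U X =
          (fun u => (holdist (L ^ n * L ^ C.scale X) (fine L (M (C.scale X))) (xB X) (yB X)) ^ (-α)
              * (((L ^ n * L ^ C.scale X : ℕ) : ℝ)
                  * (minimiser (L ^ n * L ^ C.scale X) (fine L (M (C.scale X))) (aK a L (C.scale X + n))
                        (((L ^ n * L ^ C.scale X : ℕ) : ℝ) ^ 2) (m2 * ((L : ℝ) ^ C.scale X * eps L k) ^ 2) (Pi.single u 1)
                        (xB X + unitVec (fine (L ^ n * L ^ C.scale X) (fine L (M (C.scale X)))) (dir X))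
                      - minimiser (L ^ n * L ^ C.scale X) (fine L (M (C.scale X))) (aK a L (C.scale X + n))
                        (((L ^ n * L ^ C.scale X : ℕ) : ℝ) ^ 2) (m2 * ((L : ℝ) ^ C.scale X * eps L k) ^ 2) (Pi.single u 1)
                        (xB X))
                - ((L ^ n * L ^ C.scale X : ℕ) : ℝ)
                  * (minimiser (L ^ n * L ^ C.scale X) (fine L (M (C.scale X))) (aK a L (C.scale X + n))
                        (((L ^ n * L ^ C.scale X : ℕ) : ℝ) ^ 2) (m2 * ((L : ℝ) ^ C.scale X * eps L k) ^ 2) (Pi.single u 1)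
                        (yB X + unitVec (fine (L ^ n * L ^ C.scale X) (fine L (M (C.scale X)))) (dir X))
                      - minimiser (L ^ n * L ^ C.scale X) (fine L (M (C.scale X))) (aK a L (C.scale X + n))
                        (((L ^ n * L ^ C.scale X : ℕ) : ℝ) ^ 2) (m2 * ((L : ℝ) ^ C.scale X * eps L k) ^ 2) (Pi.single u 1)
                        (yB X))))
            ⬝ᵥ ((effLaplacian (L ^ n * L ^ C.scale X) (fine L (M (C.scale X))) (aK a L (C.scale X + n))
                    (((L ^ n * L ^ C.scale X : ℕ) : ℝ) ^ 2) (m2 * ((L : ℝ) ^ C.scale X * eps L k) ^ 2)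
                  + (a * ((L : ℝ) ^ 2)⁻¹) • blockProj L (M (C.scale X)))⁻¹
                *ᵥ fun w => minimiser (L ^ n * L ^ C.scale X) (fine L (M (C.scale X))) (aK a L (C.scale X + n))
                    (((L ^ n * L ^ C.scale X : ℕ) : ℝ) ^ 2) (m2 * ((L : ℝ) ^ C.scale X * eps L k) ^ 2) (Pi.single w 1) (zB X)))
        (W : Set (ℕ → ℝ)),
        NE5 EA EB W κ ((L : ℝ) ^ (-(γ / 2))) C₅ := by
  have hL1 : 1 ≤ L := by have := hLp.2; omega
  obtain ⟨κ, C₅, hκ, hC₅, H⟩ := ne5_kingModel_threeFactorHolderDeriv_torus_unif hd L hLp ha hm hα hγ hαγ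
  exact ⟨κ, C₅, hκ, hC₅, fun k n hn M _ hM C hsc hsk dir xA yA zA xB yB zB hx hy hz hdd EA EB hEA hEB W =>
    H n hn M hM C hsc dir xA yA zA xB yB zB hx hy hz hdd (fun X => m2 * ((L : ℝ) ^ C.scale X * eps L k) ^ 2)
      (fun X => physMass_pos hL1 hm _ _) (fun X => physMass_le_cap hL1 hm.le (hsk X)) EA EB hEA hEB W⟩

end Summit.QuantumFields.YangMills.BalabanUVNodes.N18KingModelTorusHolderDerivMassUniform

end
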